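import Summits.KontsevichZagierPeriods.KontsevichZagierPeriods.Theorems.RootDecompRelativeModAbsoluteLogFoldingDegOne.Negative.FalseOfLogLinearDescent
import Summits.KontsevichZagierPeriods.KontsevichZagierPeriods.Theorems.LiouvilleUnfoldingLogPrimitiveNLStubDescent
import Summits.KontsevichZagierPeriods.KontsevichZagierPeriods.Theorems.LiouvilleUnfoldingLogPrimitiveNLStubPeelingStep
import Summits.KontsevichZagierPeriods.KontsevichZagierPeriods.Theorems.LiouvilleUnfoldingLogPrimitiveNLStubConstRigidity

/-!
# Refutation of item `LogFoldingDegOne` (stmt-KontsevichZagierPeriods-29577, route `RootDecompRelativeModAbsolute`)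

Unconditional composition of the two landed negative lemmas with the tree's log-linear descent chain.
-/

noncomputable section

namespace Summit.KontsevichZagierPeriods.RootDecompRelativeModAbsolute

open Summit.KontsevichZagierPeriods.LiouvilleUnfolding.LogPrimitiveNL
  (stub_descent stub_peelingStep stub_constRigidity)
open Summit.KontsevichZagierPeriods.RootDecompRelativeModAbsolute.LogFoldingDegOneNegative
  (not_logFoldingDegOne_of_logLinearDescent)

/-- Refutes `RootDecompRelativeModAbsolute.LogFoldingDegOne` [refuted-misstated]: the degree-one
folding item asserts that every `t`-degree-≤-1 rational fibred datum over a 1-dimensional base folds to an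
ADMISSIBLE log term (`KZlog.Term.Admissible`: termwise integrable `h₀`, `hᵢ`, with `1 ≤ vᵢ`); witness
`r₀ = [(0,1)², t/(1+xt)]`, whose fibre function is `F(x) = 1/x − log(1+x)/x²` on `(0,1)`: log-linear descent
(tree theorem `stub_descent stub_peelingStep stub_constRigidity`, Kolchin–Ostrowski along the base + Baker at
algebraic points) forces `h₀ = x⁻¹` a.e. on `(0,1)` for any admissible term a.e. equal to `F`, contradicting
`IntegrableOn h₀ σ` (landed `Negative/Witness.lean` p765124, `Negative/FalseOfLogLinearDescent.lean` p765929).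
Repaired statement C′ (believed true): `LogFoldingDegOne` restricted to data whose leading `t`-coefficient
has no zero on the closure of the base (equivalently: after the route's regularisation `RegFoldingDegOne`,
item 30571, now PROVED) — the witness misses C′ (its leading coefficient `x` vanishes at the endpoint `0`).
[folklore] -/
theorem RootDecompRelativeModAbsoluteLogFoldingDegOne_refuted :
    ¬ Summit.KontsevichZagierPeriods.KontsevichZagierPeriods.Theses.RootDecompRelativeModAbsolute.LogFoldingDegOne :=
  not_logFoldingDegOne_of_logLinearDescent (stub_descent stub_peelingStep stub_constRigidity)

end Summit.KontsevichZagierPeriods.RootDecompRelativeModAbsolute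

end
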